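import Mathlib
import Summits.ValiantsHypothesis.ValiantsHypothesis.Theorems.NewtonUnitEquationsNewtonTauWeakCoreSplitting
import Summits.ValiantsHypothesis.ValiantsHypothesis.Theorems.NewtonUnitEquationsNewtonTauWeakFourCoreChartRel

/-!
# `NewtonUnitEquationsNewtonTauWeakCoreSplittingRel` — Minkowski splitting along `c = a + b`, read through `V`

Line `binomial-normal-form` of crux `NewtonTauWeak` (stmt-ValiantsHypothesis-5904), lead c7, stub P11: the general
MINKOWSKI SPLITTING THEOREM in chart language (the landed stub P7 `stub_coreSplitting`) read THROUGH a sub-universe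
`V ⊆ Fin x`.  A design on `c = a + b` cores is `h : Fin (a + b) → Finset (Fin x) → ℕ²`; a configuration
`f : Fin x → Fin (a + b)` (attached element `u` joins core `f u`) has the `V`-relative point
`P_V f = Σ_d h d (V ∩ f⁻¹ d)` (elements outside `V` are ignored).  For a finite `S ⊆ ℕ²` the CHART POINTS of `S`
(chart `σ = −1`) are the `p ∈ S` that are the unique maximiser over `S` of some height `q ↦ t·q₀ − q₁`, `t ∈ ℝ`
(the lower-hull vertices).  The stub bounds `|U(im P_V)| + 2^{|V|}` by `Σ_{W ⊆ V} (|U(A_W)| + |U(B_W)|)`, where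
`A_W` is the cloud of the SUB-DESIGN on the first `a` cores read only on `V \ W`
(`φ : Fin x → Fin a ↦ Σ_{d<a} h (castAdd b d) ((V \ W) ∩ φ⁻¹ d)`) and `B_W` the cloud of the sub-design on the last
`b` cores read only on `W` (`ψ : Fin x → Fin b ↦ Σ_{d<b} h (natAdd a d) (W ∩ ψ⁻¹ d)`).

Proof (the argument of the absolute case `stub_coreSplitting`, `V = univ`, conditioned on the RELATIVE slices
`W ⊆ V`).  GLUING (`sum_glue`): the configuration glued from `φ` off `W` and `ψ` on `W` has `V`-relative point
`A_{V ∩ W}`-summand of `φ` `+` `B_{V ∩ W}`-summand of `ψ` (the `V`-relative fibres are `(V \ W) ∩ φ⁻¹ i` and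
`(V ∩ W) ∩ ψ⁻¹ j`); for `W ⊆ V` this puts the planar sumset `A_W ⊕ B_W` inside `im P_V`, and, since every `f` is so
glued along its own absolute slice (`CoreSplittingAux.exists_glue`), `P_V f ∈ A_W ⊕ B_W` for the relative slice
`W = V ∩ {u : a ≤ f u} ⊆ V`.  Hence a chart point of `im P_V` is a chart point (same `t`) of the sumset of its own
relative slice, `U(im P_V) ⊆ ⋃_{W ⊆ V} U(A_W ⊕ B_W)`, and by the chart lemma for planar Minkowski sums (the landed
brick `stub_sumsetChartCount`, `σ = −1 ≠ 0`) `|U(A_W ⊕ B_W)| + 1 ≤ |U(A_W)| + |U(B_W)|` for each of the `2^{|V|}`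
slices (`A_W`, `B_W` are nonempty because `1 ≤ a`, `1 ≤ b`).  Summing over `W ⊆ V` gives the claim; everything stays
in `ℕ` in the shape `· + 2^{|V|} ≤ ·`.

`stub_coreSplittingRel` is the registered stub text, verbatim; it is a one-line specialisation of `core_bound`, the
same statement with the three point maps abstracted.  Folklore-level; Mathlib and the landed bricks only; no
citations, no `def`s.
-/

-- Sub = Summit single-conjunct layout: the duplicated namespace component is mandated by the tree.
set_option linter.dupNamespace false

open scoped BigOperators

namespace Summit.ValiantsHypothesis.ValiantsHypothesis.Theorems.NewtonUnitEquationsNewtonTauWeak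

namespace CoreSplittingRelAux

/-- RELATIVE GLUING: the configuration glued from `φ` off `W` and `ψ` on `W` has `V`-relative fibre
`(V \ W) ∩ φ⁻¹ i` over the core `castAdd b i` and `(V ∩ W) ∩ ψ⁻¹ j` over the core `natAdd a j`, so its
`V`-relative point is the `A`-summand of `φ` on `V \ W` plus the `B`-summand of `ψ` on `V ∩ W` (split
`Σ_{d : Fin (a+b)}` into the two blocks). [folklore] -/
theorem sum_glue {a b x : ℕ} (h : Fin (a + b) → Finset (Fin x) → (Fin 2 →₀ ℕ)) (V W : Finset (Fin x))
    (φ : Fin x → Fin a) (ψ : Fin x → Fin b) (g : Fin x → Fin (a + b))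
    (hg : ∀ u, g u = if u ∈ W then Fin.natAdd a (ψ u) else Fin.castAdd b (φ u)) :
    ∑ d, h d (V ∩ Finset.univ.filter fun u => g u = d) =
      (∑ d, h (Fin.castAdd b d) ((V \ W) ∩ Finset.univ.filter fun u => φ u = d)) +
        ∑ d, h (Fin.natAdd a d) ((V ∩ W) ∩ Finset.univ.filter fun u => ψ u = d) := by
  rw [Fin.sum_univ_add]
  simp only [CoreSplittingAux.filter_glue_castAdd W φ ψ g hg, CoreSplittingAux.filter_glue_natAdd W φ ψ g hg,
    Finset.inter_assoc, Finset.sdiff_eq_inter_compl]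

/-- **RELATIVE CORE BOUND** — the registered stub with the three point maps abstracted: `P` (whole design read
through `V`), `PA W` (first block read on `V \ W`), `PB W` (second block read on `W`).
`|U(im P)| + 2^{|V|} ≤ Σ_{W ⊆ V} (|U(im PA W)| + |U(im PB W)|)`: slice relative to `V`, glue, and apply the chart
lemma for planar sumsets slice by slice. [folklore] -/
theorem core_bound {a b x : ℕ} (ha : 1 ≤ a) (hb : 1 ≤ b) (V : Finset (Fin x))
    (h : Fin (a + b) → Finset (Fin x) → (Fin 2 →₀ ℕ)) (P : (Fin x → Fin (a + b)) → (Fin 2 →₀ ℕ))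
    (PA : Finset (Fin x) → (Fin x → Fin a) → (Fin 2 →₀ ℕ)) (PB : Finset (Fin x) → (Fin x → Fin b) → (Fin 2 →₀ ℕ))
    (hP : ∀ f, P f = ∑ d, h d (V ∩ Finset.univ.filter fun u => f u = d))
    (hPA : ∀ W φ, PA W φ = ∑ d, h (Fin.castAdd b d) ((V \ W) ∩ Finset.univ.filter fun u => φ u = d))
    (hPB : ∀ W ψ, PB W ψ = ∑ d, h (Fin.natAdd a d) (W ∩ Finset.univ.filter fun u => ψ u = d)) :
    {p : Fin 2 →₀ ℕ | p ∈ Finset.univ.image P ∧ ∃ t : ℝ, ∀ q ∈ Finset.univ.image P, q ≠ p →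
        t * ((q 0 : ℕ) : ℝ) + (-1) * ((q 1 : ℕ) : ℝ) < t * ((p 0 : ℕ) : ℝ) + (-1) * ((p 1 : ℕ) : ℝ)}.ncard +
        2 ^ V.card ≤
      ∑ W ∈ V.powerset,
        ({p : Fin 2 →₀ ℕ | p ∈ Finset.univ.image (PA W) ∧ ∃ t : ℝ, ∀ q ∈ Finset.univ.image (PA W), q ≠ p →
            t * ((q 0 : ℕ) : ℝ) + (-1) * ((q 1 : ℕ) : ℝ) < t * ((p 0 : ℕ) : ℝ) + (-1) * ((p 1 : ℕ) : ℝ)}.ncard +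
          {p : Fin 2 →₀ ℕ | p ∈ Finset.univ.image (PB W) ∧ ∃ t : ℝ, ∀ q ∈ Finset.univ.image (PB W), q ≠ p →
            t * ((q 0 : ℕ) : ℝ) + (-1) * ((q 1 : ℕ) : ℝ) < t * ((p 0 : ℕ) : ℝ) + (-1) * ((p 1 : ℕ) : ℝ)}.ncard) := by
  -- the chart set `U W` of the sumset `A_W ⊕ B_W` of the slice `W`
  obtain ⟨U, hU⟩ : ∃ U : Finset (Fin x) → Set (Fin 2 →₀ ℕ), ∀ W, U W =
      {p : Fin 2 →₀ ℕ | p ∈ (Finset.univ.image (PA W) ×ˢ Finset.univ.image (PB W)).image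
            (fun pq : (Fin 2 →₀ ℕ) × (Fin 2 →₀ ℕ) => pq.1 + pq.2) ∧
        ∃ t : ℝ, ∀ q ∈ (Finset.univ.image (PA W) ×ˢ Finset.univ.image (PB W)).image
            (fun pq : (Fin 2 →₀ ℕ) × (Fin 2 →₀ ℕ) => pq.1 + pq.2), q ≠ p →
          t * ((q 0 : ℕ) : ℝ) + (-1) * ((q 1 : ℕ) : ℝ) < t * ((p 0 : ℕ) : ℝ) + (-1) * ((p 1 : ℕ) : ℝ)} :=
    ⟨_, fun _ => rfl⟩
  -- the factor clouds are nonempty (`1 ≤ a`, `1 ≤ b`: constant configurations exist)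
  have hAne : ∀ W, (Finset.univ.image (PA W)).Nonempty := fun W =>
    ⟨_, Finset.mem_image_of_mem _ (Finset.mem_univ fun _ : Fin x => (⟨0, ha⟩ : Fin a))⟩
  have hBne : ∀ W, (Finset.univ.image (PB W)).Nonempty := fun W =>
    ⟨_, Finset.mem_image_of_mem _ (Finset.mem_univ fun _ : Fin x => (⟨0, hb⟩ : Fin b))⟩
  -- GLUING BACK (slices `W ⊆ V`): every point of a slice sumset is the `V`-relative point of a configuration
  have hsumsub : ∀ W : Finset (Fin x), W ⊆ V → ∀ q : Fin 2 →₀ ℕ,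
      q ∈ (Finset.univ.image (PA W) ×ˢ Finset.univ.image (PB W)).image
        (fun pq : (Fin 2 →₀ ℕ) × (Fin 2 →₀ ℕ) => pq.1 + pq.2) → q ∈ Finset.univ.image P := by
    intro W hWV q hq
    obtain ⟨p₁, hp₁, p₂, hp₂, rfl⟩ := SumsetChartCountAux.mem_sumset_iff.mp hq
    obtain ⟨φ, -, rfl⟩ := Finset.mem_image.mp hp₁
    obtain ⟨ψ, -, rfl⟩ := Finset.mem_image.mp hp₂
    refine Finset.mem_image.mpr
      ⟨fun u => if u ∈ W then Fin.natAdd a (ψ u) else Fin.castAdd b (φ u), Finset.mem_univ _, ?_⟩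
    rw [hP, hPA, hPB]
    refine (sum_glue h V W φ ψ _ fun _ => rfl).trans ?_
    rw [Finset.inter_eq_right.mpr hWV]
  -- each chart set is finite
  have hfin : ∀ W, (U W).Finite := fun W => by
    rw [hU]
    exact (Finset.finite_toSet _).subset fun p hp => hp.1
  -- SLICING: a chart point of the whole cloud is a chart point (same `t`) of the sumset of its own relative slice
  -- `V ∩ W ⊆ V`, `W = {u : a ≤ f u}` the absolute slice of `f`
  have hsub : {p : Fin 2 →₀ ℕ | p ∈ Finset.univ.image P ∧ ∃ t : ℝ, ∀ q ∈ Finset.univ.image P, q ≠ p →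
      t * ((q 0 : ℕ) : ℝ) + (-1) * ((q 1 : ℕ) : ℝ) < t * ((p 0 : ℕ) : ℝ) + (-1) * ((p 1 : ℕ) : ℝ)} ⊆
      ⋃ W ∈ V.powerset, U W := by
    rintro p ⟨hp, t, ht⟩
    obtain ⟨f, -, rfl⟩ := Finset.mem_image.mp hp
    obtain ⟨W, φ, ψ, hf⟩ := CoreSplittingAux.exists_glue ha hb f
    have hWV : V ∩ W ⊆ V := Finset.inter_subset_left
    refine Set.mem_iUnion₂_of_mem (Finset.mem_powerset.mpr hWV) ?_
    rw [hU, Set.mem_setOf_eq]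
    refine ⟨?_, t, fun q hq hne => ht q (hsumsub (V ∩ W) hWV q hq) hne⟩
    rw [hP, sum_glue h V W φ ψ f hf, ← Finset.sdiff_inter_self_left V W, ← hPA, ← hPB]
    exact SumsetChartCountAux.add_mem_sumset (Finset.mem_image_of_mem _ (Finset.mem_univ _))
      (Finset.mem_image_of_mem _ (Finset.mem_univ _))
  -- COUNTING over the `2 ^ |V|` slices `W ⊆ V` with the chart lemma for planar sumsets (`σ = -1`)
  have h1 := (Set.ncard_le_ncard hsub ((Finset.finite_toSet _).biUnion fun W _ => hfin W)).trans
    (Finset.set_ncard_biUnion_le _ _)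
  have hσ : (-1 : ℝ) ≠ 0 := by norm_num
  calc _ ≤ (∑ W ∈ V.powerset, (U W).ncard) + 2 ^ V.card := Nat.add_le_add_right h1 _
    _ = ∑ W ∈ V.powerset, ((U W).ncard + 1) := by
      rw [Finset.sum_add_distrib, FourCoreChartRelAux.sum_one_eq]
    _ ≤ _ := Finset.sum_le_sum fun W _ => by
      rw [hU]
      exact stub_sumsetChartCount (-1) hσ _ _ (hAne W) (hBne W)

end CoreSplittingRelAux

/-- **STUB P11 `stub_coreSplittingRel`** (registered signature, verbatim) — the MINKOWSKI SPLITTING THEOREM for a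
design on `c = a + b` cores read through a sub-universe `V ⊆ Fin x`, in chart language: the lower-hull vertices
(chart points, `σ = -1`) of the cloud of `V`-relative points of all configurations, plus `2^{|V|}`, number at most the
sum over the slices `W ⊆ V` of the chart-point counts of the two sub-design clouds (first `a` cores read on `V \ W`,
last `b` cores read on `W`). [folklore] -/
theorem stub_coreSplittingRel (a b x : ℕ) (ha : 1 ≤ a) (hb : 1 ≤ b) (V : Finset (Fin x))
    (h : Fin (a + b) → Finset (Fin x) → (Fin 2 →₀ ℕ)) :
    {p : Fin 2 →₀ ℕ | p ∈ (Finset.univ.image fun f : Fin x → Fin (a + b) =>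
          ∑ d, h d (V ∩ Finset.univ.filter fun u => f u = d)) ∧
        ∃ t : ℝ, ∀ q ∈ (Finset.univ.image fun f : Fin x → Fin (a + b) =>
          ∑ d, h d (V ∩ Finset.univ.filter fun u => f u = d)), q ≠ p →
          t * ((q 0 : ℕ) : ℝ) + (-1) * ((q 1 : ℕ) : ℝ) < t * ((p 0 : ℕ) : ℝ) + (-1) * ((p 1 : ℕ) : ℝ)}.ncard + 2 ^ V.card ≤
      ∑ W ∈ V.powerset,
        ({p : Fin 2 →₀ ℕ | p ∈ (Finset.univ.image fun φ : Fin x → Fin a =>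
          ∑ d, h (Fin.castAdd b d) ((V \ W) ∩ Finset.univ.filter fun u => φ u = d)) ∧
            ∃ t : ℝ, ∀ q ∈ (Finset.univ.image fun φ : Fin x → Fin a =>
          ∑ d, h (Fin.castAdd b d) ((V \ W) ∩ Finset.univ.filter fun u => φ u = d)), q ≠ p →
              t * ((q 0 : ℕ) : ℝ) + (-1) * ((q 1 : ℕ) : ℝ) < t * ((p 0 : ℕ) : ℝ) + (-1) * ((p 1 : ℕ) : ℝ)}.ncard +
         {p : Fin 2 →₀ ℕ | p ∈ (Finset.univ.image fun ψ : Fin x → Fin b =>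
          ∑ d, h (Fin.natAdd a d) (W ∩ Finset.univ.filter fun u => ψ u = d)) ∧
            ∃ t : ℝ, ∀ q ∈ (Finset.univ.image fun ψ : Fin x → Fin b =>
          ∑ d, h (Fin.natAdd a d) (W ∩ Finset.univ.filter fun u => ψ u = d)), q ≠ p →
              t * ((q 0 : ℕ) : ℝ) + (-1) * ((q 1 : ℕ) : ℝ) < t * ((p 0 : ℕ) : ℝ) + (-1) * ((p 1 : ℕ) : ℝ)}.ncard) := by
  exact CoreSplittingRelAux.core_bound ha hb V h (fun f => ∑ d, h d (V ∩ Finset.univ.filter fun u => f u = d))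
    (fun W φ => ∑ d, h (Fin.castAdd b d) ((V \ W) ∩ Finset.univ.filter fun u => φ u = d))
    (fun W ψ => ∑ d, h (Fin.natAdd a d) (W ∩ Finset.univ.filter fun u => ψ u = d))
    (fun _ => rfl) (fun _ _ => rfl) (fun _ _ => rfl)

end Summit.ValiantsHypothesis.ValiantsHypothesis.Theorems.NewtonUnitEquationsNewtonTauWeak
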